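import Literature.AlgebraicGeometry.Motives.MumfordTateInvariantsDerivation
import Mathlib.LinearAlgebra.PiTensorProduct.Basis
import Mathlib.GroupTheory.Perm.Sign
import HarnessLib

/-!
# Group-antisymmetrised («determinant») tensors in a tensor power: alternation, equivariance under the derivation action,
# and the eigenvalue `Σᵢ Y_{y₀ i, y₀ i}` of a block-preserving operator (Deligne 1982, I §3.1; Moonen–Zarhin 1999, §3)

Family `hodge`, layer `Literature/AlgebraicGeometry/Motives`.  THEOREMS ONLY (no definition, no named fact).  Written for the
cell `pub-hodgecm2` (COR-CM), seat `b27` gen 55 (count-neutral Mumford–Tate-rank ladder, «the centre», part 1: multilinear algebra).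

PURPOSE.  The proof that EVERY polarizable `ℚ`-Hodge structure is `Θ`-rigid (part 5, `Motives/HodgeLieRigid`) produces, for a
semisimple Hodge endomorphism `z` with eigenspaces `V_λ ⊆ V_ℂ` of dimensions `m_λ`, the «determinant tensors»
`t_w = ⊗_λ (det V_λ)^{⊗ w_λ} ∈ V_ℂ^{⊗a}`, `a = Σ_λ m_λ w_λ`, killed by the Hodge Lie algebra (Deligne, LNM 900, I §3.1: the Mumford–Tate
group is cut out by tensors; here the tensors that compute the characters of its centre).  This file is the basis-free multilinear
algebra of such tensors over any field `K`, for a `K`-module `W`, a number of slots `a`, and a labelling `grp : Fin a → β` of the slots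
by «groups»:

* the GROUP ANTISYMMETRISER `A = Σ_{π ∈ G} sgn(π) · π_*` on `W^{⊗a}`, `G = {π ∈ 𝔖_a | grp ∘ π = grp}` the permutations preserving
  every group, `π_*` Mathlib's `PiTensorProduct.reindex` (NO definition is declared: `A` is a variable bound by the hypothesis `hA`
  spelling out this sum, exactly as the statements below consume it);
* `antisym_tprod` — `A (⊗ᵢ vᵢ) = Σ_{π ∈ G} sgn(π) ⊗ᵢ v_{π⁻¹ i}`;
* **`antisym_tprod_eq_zero_of_eq`** — ALTERNATION: `A (⊗ᵢ vᵢ) = 0` as soon as `vᵢ = vⱼ` for two slots `i ≠ j` of the same group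
  (the involution `π ↦ π ∘ (i j)` on `G`);
* `reindex_comp_piTensorDerivation`, **`antisym_comp_piTensorDerivation`** — the derivation action `ρ(X) = Σₖ 1 ⊗ ⋯ ⊗ X ⊗ ⋯ ⊗ 1`
  of `X ∈ End W` (the tree's `piTensorDerivation`, `Motives/MumfordTateInvariantsDerivation`) commutes with every `π_*`, hence with `A`;
* `tprod_eq_sum_basis` — expansion of a pure tensor in the tensor basis `⊗ᵢ e_{y i}` of a basis `e` of `W`;
* **`piTensorDerivation_antisym_tprod_basis`** — THE EIGENVALUE: for a basis `e` of `W` labelled by «blocks» `blk : S → γ`, an index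
  `y₀ : Fin a → S` mapping every group BIJECTIVELY onto a block, and an operator `Y` preserving the blocks
  (`e^*_{σ'}(Y e_σ) = 0` unless `blk σ' = blk σ`): `ρ(Y) · A(⊗ᵢ e_{y₀ i}) = (Σᵢ e^*_{y₀ i}(Y e_{y₀ i})) · A(⊗ᵢ e_{y₀ i})` — the
  infinitesimal form of «`g` acts on `det V_λ` by `det(g|V_λ)`»: `Y` acts on `⊗_λ (det V_λ)^{⊗w_λ}` by `Σ_λ w_λ tr(Y|V_λ)`;
* `antisym_tprod_basis_ne_zero` — `A(⊗ᵢ e_{y₀ i}) ≠ 0` when `y₀` is injective on every group (its `y₀`-coordinate is `1`).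

## References
* [Deligne1982HodgeCycles] P. Deligne, *Hodge cycles on abelian varieties*, LNM 900 (1982), I §3.1 (the tensor spaces `T^{a,b}` and
  the action of `GL(V)`), proof of Prop. 3.4. [cite: Deligne1982HodgeCycles, I §3.1 and proof of Prop. 3.4]
* [MoonenZarhin1999LowDim] B. Moonen, Yu. G. Zarhin, Math. Ann. 315 (1999), §3 (3.1) [corpus: paper:arxiv-math_9901113 p. 6].
  [cite: MoonenZarhin1999LowDim, §3 (3.1)]
* [BourbakiAlgebraI1989] N. Bourbaki, *Algebra I. Chapters 1–3* (1989), Ch. III §7.4 (antisymmetrisation, exterior powers) and §8.1 (determinants).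
  [cite: BourbakiAlgebraI1989, III §7.4 and §8.1]
-/

noncomputable section

open scoped TensorProduct PiTensorProduct

namespace Literature.AlgebraicGeometry.Motives

universe u v w

variable {K : Type u} [Field K] {W : Type v} [AddCommGroup W] [Module K W] {a : ℕ}
variable {β : Type w} [DecidableEq β] (grp : Fin a → β)
variable (A : Module.End K (⨂[K]^a W))
  (hA : A = ∑ π ∈ Finset.univ.filter (fun π : Equiv.Perm (Fin a) => ∀ i, grp (π i) = grp i),
    ((Equiv.Perm.sign π : ℤ) : K) • (PiTensorProduct.reindex K (fun _ : Fin a => W) π).toLinearMap)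

/-! ### §1 The group antisymmetriser on pure tensors; alternation -/

include hA in
/-- `A (⊗ᵢ vᵢ) = Σ_{π ∈ G} sgn(π) ⊗ᵢ v_{π⁻¹ i}`. [cite: BourbakiAlgebraI1989, III §7.4] -/
theorem antisym_tprod (v : Fin a → W) :
    A (PiTensorProduct.tprod K v) =
      ∑ π ∈ Finset.univ.filter (fun π : Equiv.Perm (Fin a) => ∀ i, grp (π i) = grp i),
        ((Equiv.Perm.sign π : ℤ) : K) • PiTensorProduct.tprod K fun i => v (π.symm i) := by
  rw [hA, LinearMap.sum_apply]
  refine Finset.sum_congr rfl fun π _ => ?_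
  rw [LinearMap.smul_apply, LinearEquiv.coe_coe, PiTensorProduct.reindex_tprod]

include hA in
/-- **Alternation**: if two slots `i ≠ j` of the same group carry the same vector, the group antisymmetriser kills the pure tensor
(pair `π` with `π ∘ (i j)`, which has the opposite sign and the same tensor). [cite: BourbakiAlgebraI1989, III §7.4] -/
theorem antisym_tprod_eq_zero_of_eq (v : Fin a → W) {i j : Fin a} (hij : i ≠ j) (hg : grp i = grp j)
    (hv : v i = v j) : A (PiTensorProduct.tprod K v) = 0 := by
  classical
  rw [antisym_tprod grp A hA]
  have hvswap : ∀ x, v (Equiv.swap i j x) = v x := by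
    intro x
    rw [Equiv.swap_apply_def]
    split_ifs with h1 h2
    · rw [h1, hv]
    · rw [h2, hv]
    · rfl
  have hgswap : ∀ x, grp (Equiv.swap i j x) = grp x := by
    intro x
    rw [Equiv.swap_apply_def]
    split_ifs with h1 h2
    · rw [h1, hg]
    · rw [h2, hg]
    · rfl
  refine Finset.sum_involution (fun π _ => π * Equiv.swap i j) ?_ ?_ ?_ ?_
  · intro π _
    have htp : (PiTensorProduct.tprod K fun k => v ((π * Equiv.swap i j).symm k)) =
        PiTensorProduct.tprod K fun k => v (π.symm k) := by
      congr 1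
      funext k
      change v (Equiv.swap i j (π.symm k)) = v (π.symm k)
      exact hvswap _
    rw [htp, Equiv.Perm.sign_mul, Equiv.Perm.sign_swap hij, ← add_smul]
    have h0 : ((Equiv.Perm.sign π : ℤ) : K) + (((Equiv.Perm.sign π * -1 : ℤˣ) : ℤ) : K) = 0 := by
      push_cast
      ring
    rw [h0, zero_smul]
  · intro π _ _ h
    exact hij (Equiv.mul_swap_eq_iff.1 h)
  · intro π hπ
    simp only [Finset.mem_filter, Finset.mem_univ, true_and] at hπ ⊢
    intro k
    rw [Equiv.Perm.mul_apply, hπ, hgswap]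
  · intro π _
    rw [mul_assoc, Equiv.swap_mul_self, mul_one]

/-! ### §2 Permutations of the slots commute with the derivation action -/

omit [DecidableEq β] in
/-- `π_* ∘ ρ(X) = ρ(X) ∘ π_*` on `W^{⊗a}` for every permutation `π` of the slots: the derivation action is symmetric in the slots.
[cite: Deligne1982HodgeCycles, I §3.1 and proof of Prop. 3.4] -/
theorem reindex_comp_piTensorDerivation (π : Equiv.Perm (Fin a)) (X : Module.End K W) :
    (PiTensorProduct.reindex K (fun _ : Fin a => W) π).toLinearMap ∘ₗ piTensorDerivation a X =
      piTensorDerivation a X ∘ₗ (PiTensorProduct.reindex K (fun _ : Fin a => W) π).toLinearMap := by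
  classical
  apply PiTensorProduct.ext
  apply MultilinearMap.ext
  intro v
  simp only [LinearMap.compMultilinearMap_apply, LinearMap.coe_comp, Function.comp_apply, LinearEquiv.coe_coe,
    PiTensorProduct.reindex_tprod, piTensorDerivation_tprod, map_sum]
  have hupd : ∀ k : Fin a, (fun i => Function.update v k (X (v k)) (π.symm i)) =
      Function.update (fun i => v (π.symm i)) (π k) (X (v k)) := by
    intro k
    funext i
    rw [Function.update_apply_equiv_apply v π.symm k (X (v k)) i, Equiv.symm_symm]
    rfl
  simp only [hupd]
  rw [← Equiv.sum_comp π (fun k' => PiTensorProduct.tprod K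
    (Function.update (fun i => v (π.symm i)) k' (X (v (π.symm k')))))]
  refine Finset.sum_congr rfl fun k _ => ?_
  rw [Equiv.symm_apply_apply]

include hA in
/-- **The group antisymmetriser commutes with the derivation action**: `A (ρ(X) t) = ρ(X) (A t)`.
[cite: Deligne1982HodgeCycles, I §3.1 and proof of Prop. 3.4] -/
theorem antisym_piTensorDerivation_apply (X : Module.End K W) (t : ⨂[K]^a W) :
    A (piTensorDerivation a X t) = piTensorDerivation a X (A t) := by
  rw [hA, LinearMap.sum_apply, LinearMap.sum_apply, map_sum]
  refine Finset.sum_congr rfl fun π _ => ?_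
  rw [LinearMap.smul_apply, LinearMap.smul_apply, map_smul, LinearEquiv.coe_coe]
  congr 1
  have h := reindex_comp_piTensorDerivation (K := K) (W := W) π X
  exact LinearMap.congr_fun h t

include hA in
/-- `A ∘ ρ(X) = ρ(X) ∘ A`. [cite: Deligne1982HodgeCycles, I §3.1 and proof of Prop. 3.4] -/
theorem antisym_comp_piTensorDerivation (X : Module.End K W) :
    A ∘ₗ piTensorDerivation a X = piTensorDerivation a X ∘ₗ A :=
  LinearMap.ext fun t => antisym_piTensorDerivation_apply grp A hA X t

/-! ### §3 In a basis: expansion, the eigenvalue of a block-preserving operator, non-vanishing -/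

section Basis

variable {S : Type*} [Fintype S] (e : Module.Basis S K W)

omit [DecidableEq β] in
/-- Expansion of a pure tensor in the tensor basis of a basis `e` of `W`:
`⊗ᵢ xᵢ = Σ_y (∏ᵢ e^*_{y i}(xᵢ)) · ⊗ᵢ e_{y i}` (Mathlib's `Basis.piTensorProduct`). [cite: BourbakiAlgebraI1989, III §7.4] -/
theorem tprod_eq_sum_basis (x : Fin a → W) :
    PiTensorProduct.tprod K x =
      ∑ y : Fin a → S, (∏ i, e.repr (x i) (y i)) • PiTensorProduct.tprod K fun i => e (y i) := by
  classical
  set E := Basis.piTensorProduct (fun _ : Fin a => e) with hE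
  conv_lhs => rw [← E.sum_repr (PiTensorProduct.tprod K x)]
  refine Finset.sum_congr rfl fun y _ => ?_
  rw [hE, Basis.piTensorProduct_repr_tprod_apply, Basis.piTensorProduct_apply]

include hA in
/-- **The eigenvalue of a block-preserving operator on a group-antisymmetrised basis tensor.**  Let the basis `e` be labelled by
blocks `blk : S → γ`, let `y₀ : Fin a → S` map every group ONTO the block it meets, and let
`Y ∈ End W` preserve the blocks (`e^*_{σ'}(Y e_σ) = 0` unless `blk σ' = blk σ`).  Then
`ρ(Y) A(⊗ᵢ e_{y₀ i}) = (Σᵢ e^*_{y₀ i}(Y e_{y₀ i})) A(⊗ᵢ e_{y₀ i})`: expanding `Y e_{y₀ i}` in the block, every off-diagonal term puts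
the same basis vector in two slots of one group and is killed by alternation — the Lie-algebra form of «`GL(V_λ)` acts on
`det V_λ` through `det`», i.e. `Y` acts on `⊗_λ (det V_λ)^{⊗ w_λ}` by `Σ_λ w_λ tr(Y|V_λ)`. [cite: BourbakiAlgebraI1989, III §8.1]
[cite: Deligne1982HodgeCycles, I §3.1 and proof of Prop. 3.4] -/
theorem piTensorDerivation_antisym_tprod_basis {γ : Type*} (blk : S → γ) (y₀ : Fin a → S)
    (hsurj : ∀ i σ, blk σ = blk (y₀ i) → ∃ j, grp j = grp i ∧ y₀ j = σ)
    {Y : Module.End K W} (hY : ∀ σ σ', blk σ' ≠ blk σ → e.repr (Y (e σ)) σ' = 0) :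
    piTensorDerivation a Y (A (PiTensorProduct.tprod K fun i => e (y₀ i))) =
      (∑ i, e.repr (Y (e (y₀ i))) (y₀ i)) • A (PiTensorProduct.tprod K fun i => e (y₀ i)) := by
  classical
  rw [← antisym_piTensorDerivation_apply grp A hA, piTensorDerivation_tprod, map_sum, Finset.sum_smul]
  refine Finset.sum_congr rfl fun i _ => ?_
  -- expand `Y e_{y₀ i}` in the basis
  set c : S → K := fun σ' => e.repr (Y (e (y₀ i))) σ' with hc
  have hexp : Y (e (y₀ i)) = ∑ σ', c σ' • e σ' := (e.sum_repr _).symm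
  change _ = c (y₀ i) • _
  rw [hexp, MultilinearMap.map_update_sum, map_sum]
  rw [Finset.sum_eq_single (y₀ i)]
  · rw [MultilinearMap.map_update_smul, map_smul, Function.update_eq_self]
  · intro σ' _ hσ'
    rw [MultilinearMap.map_update_smul, map_smul]
    by_cases hblk : blk σ' = blk (y₀ i)
    · obtain ⟨j, hj, hjσ⟩ := hsurj i σ' hblk
      have hji : j ≠ i := by
        rintro rfl
        exact hσ' hjσ.symm
      have hupd : Function.update (fun k => e (y₀ k)) i (e σ') = fun k => e (Function.update y₀ i σ' k) := by
        funext k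
        rw [Function.apply_update (fun _ => e) y₀ i σ' k]
      rw [hupd, antisym_tprod_eq_zero_of_eq grp A hA (fun k => e (Function.update y₀ i σ' k)) hji.symm hj.symm ?_,
        smul_zero]
      simp only [Function.update_self, Function.update_of_ne hji, hjσ]
    · rw [show c σ' = 0 from hY (y₀ i) σ' hblk, zero_smul]
  · intro h
    exact absurd (Finset.mem_univ _) h

include hA in
omit [Fintype S] in
/-- **`A(⊗ᵢ e_{y₀ i}) ≠ 0`** when `y₀` is injective on every group: its coordinate at the tensor basis index `y₀` is
`Σ_{π ∈ G, y₀ ∘ π⁻¹ = y₀} sgn(π) = sgn(1) = 1`. [cite: BourbakiAlgebraI1989, III §7.4 and §8.1] -/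
theorem antisym_tprod_basis_ne_zero (y₀ : Fin a → S) (hinj : ∀ i j, grp i = grp j → y₀ i = y₀ j → i = j) :
    A (PiTensorProduct.tprod K fun i => e (y₀ i)) ≠ 0 := by
  classical
  set E := Basis.piTensorProduct (fun _ : Fin a => e) with hE
  intro h0
  have hrepr : E.repr (A (PiTensorProduct.tprod K fun i => e (y₀ i))) y₀ = 1 := by
    rw [antisym_tprod grp A hA, map_sum, Finsupp.finsetSum_apply]
    rw [Finset.sum_eq_single (1 : Equiv.Perm (Fin a))]
    · rw [map_smul, Finsupp.smul_apply, Equiv.Perm.sign_one]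
      have h1 : (PiTensorProduct.tprod K fun i => e (y₀ ((1 : Equiv.Perm (Fin a)).symm i))) = E y₀ := by
        rw [hE, Basis.piTensorProduct_apply]; rfl
      rw [h1, E.repr_self, Finsupp.single_eq_same, Units.val_one, Int.cast_one, one_smul]
    · intro π hπ hπ1
      rw [Finset.mem_filter] at hπ
      rw [map_smul, Finsupp.smul_apply]
      have h1 : (PiTensorProduct.tprod K fun i => e (y₀ (π.symm i))) = E (fun i => y₀ (π.symm i)) := by
        rw [hE, Basis.piTensorProduct_apply]
      rw [h1, E.repr_self, Finsupp.single_apply, if_neg, smul_zero]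
      intro heq
      apply hπ1
      refine Equiv.ext fun i => ?_
      have hi : y₀ (π.symm i) = y₀ i := congr_fun heq i
      have hgi : grp (π.symm i) = grp i := by
        have := hπ.2 (π.symm i)
        rw [Equiv.apply_symm_apply] at this
        exact this.symm
      have := hinj _ _ hgi hi
      rw [Equiv.Perm.one_apply]
      calc (π i : Fin a) = π (π.symm i) := by rw [this]
        _ = i := Equiv.apply_symm_apply _ _
    · intro h1
      exact absurd (Finset.mem_filter.2 ⟨Finset.mem_univ _, fun i => rfl⟩) h1
  rw [h0, map_zero, Finsupp.zero_apply] at hrepr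
  exact zero_ne_one hrepr

end Basis

/-! ### §4 Transport to the tensor space `T^{a,0} = W^{⊗a} ⊗ (W^∨)^{⊗0}` -/

omit [DecidableEq β] in
/-- On `T^{a,0}_K W = W^{⊗a} ⊗ (W^∨)^{⊗0}` the derivation action of the tree (`tensorDerivation a 0 X`,
`Motives/MumfordTateInvariantsDerivation`) is `ρ(X) ⊗ 1`: the contravariant part is an empty sum.
[cite: Deligne1982HodgeCycles, I §3.1 and proof of Prop. 3.4] -/
theorem tensorDerivation_zero_tmul (X : Module.End K W) (t : ⨂[K]^a W) (u : ⨂[K]^0 (Module.Dual K W)) :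
    tensorDerivation a 0 X (t ⊗ₜ[K] u) = piTensorDerivation a X t ⊗ₜ[K] u := by
  rw [tensorDerivation_apply, LinearMap.sub_apply, LinearMap.rTensor_tmul, LinearMap.lTensor_tmul]
  have h0 : piTensorDerivation 0 (LinearMap.dualMap X) = 0 := by
    rw [piTensorDerivation_apply]
    exact Finset.sum_of_isEmpty _
  rw [h0, LinearMap.zero_apply, TensorProduct.tmul_zero, sub_zero]

end Literature.AlgebraicGeometry.Motives

end
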